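import Mathlib.Analysis.Polynomial.Basic
import Summits.Parity.BatemanHorn.Theorems.SoloInformedGeneralPolynomialSplit

/-!
# SoloInformedPolynomialGrowth — the size of the values of an integer polynomial along `ℕ`

Solo unit `solo-Parity-informed` (ideation tier, informed mode), session 12; `PLAN.md` §19.3(a), CLAIMS C49.

The polynomial inputs of the `π`-level localisation (`SoloInformedPolynomialPrimeCount`) for a one-polynomial
Bateman–Horn system `![g]`:

* `eval_natCast_ne_zero_of_irreducible` — an irreducible `g ∈ ℤ[X]` of degree `≥ 2` has no natural root;
* `exists_eval_natCast_pos` — positive degree and positive leading coefficient ⟹ `g(n) > 0` for `n ≥ n₀`;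
* `exists_abs_log_natAbs_eval_sub_le` — for `deg g ≥ 1` there is `B` with `|log |g(n)| - deg g · log n| ≤ B` for
  EVERY `n ≥ 1` (Mathlib's `Polynomial.isEquivalent_atTop_lead`: `g(t) ~ a t^d`, so `½|a| n^d ≤ |g(n)| ≤ 2|a| n^d`
  for large `n`; the finitely many small `n` are absorbed into `B`; `log 0 = 0` makes roots harmless).

Elementary.
-/

namespace Summit.Parity.BatemanHorn.Theorems

open Finset Filter Asymptotics Polynomial
open scoped Topology

/-! ### No natural roots, eventual positivity, logarithmic size -/

/-- An irreducible integer polynomial of degree `≥ 2` has no natural root (else `X - C n ∣ g` with a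
unit cofactor). -/
theorem eval_natCast_ne_zero_of_irreducible {g : ℤ[X]} (hirr : Irreducible g) (hdeg : 2 ≤ g.natDegree)
    (n : ℕ) : g.eval (n : ℤ) ≠ 0 := by
  intro h
  obtain ⟨q, hq⟩ := dvd_iff_isRoot.mpr (IsRoot.def.mpr h)
  rcases hirr.isUnit_or_isUnit hq with hu | hu
  · have h1 := natDegree_eq_zero_of_isUnit hu
    rw [natDegree_X_sub_C] at h1
    exact one_ne_zero h1
  · have h1 : g.natDegree = 1 := by
      rw [hq, natDegree_mul (X_sub_C_ne_zero (n : ℤ)) hu.ne_zero, natDegree_X_sub_C,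
        natDegree_eq_zero_of_isUnit hu]
    omega

/-- Evaluating the real image of `g ∈ ℤ[X]` at `n ∈ ℕ` gives `g(n)` cast to `ℝ`. -/
theorem eval_natCast_map_intCast (g : ℤ[X]) (n : ℕ) :
    (g.map (Int.castRingHom ℝ)).eval (n : ℝ) = ((g.eval (n : ℤ) : ℤ) : ℝ) := by
  rw [show ((n : ℕ) : ℝ) = ((n : ℤ) : ℝ) from (Int.cast_natCast n).symm, eval_intCast_map]
  simp

/-- A polynomial of positive degree with positive leading coefficient is eventually positive along `ℕ`. -/
theorem exists_eval_natCast_pos {g : ℤ[X]} (hdeg : 0 < g.natDegree) (hlc : 0 < g.leadingCoeff) :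
    ∃ n₀ : ℕ, ∀ n : ℕ, n₀ ≤ n → 0 < g.eval (n : ℤ) := by
  have hinj : Function.Injective (Int.castRingHom ℝ) := Int.cast_injective
  have hdegR : 0 < (g.map (Int.castRingHom ℝ)).degree := by
    rw [degree_map_eq_of_injective hinj]
    exact natDegree_pos_iff_degree_pos.mp hdeg
  have hlcR : 0 ≤ (g.map (Int.castRingHom ℝ)).leadingCoeff := by
    rw [leadingCoeff_map_of_injective hinj]
    simp only [eq_intCast]
    exact_mod_cast hlc.le
  have hT : Tendsto (fun n : ℕ => (g.map (Int.castRingHom ℝ)).eval (n : ℝ)) atTop atTop :=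
    ((g.map (Int.castRingHom ℝ)).tendsto_atTop_of_leadingCoeff_nonneg hdegR hlcR).comp
      tendsto_natCast_atTop_atTop
  obtain ⟨n₀, hn₀⟩ := eventually_atTop.mp (hT.eventually_gt_atTop 0)
  refine ⟨n₀, fun n hn => ?_⟩
  have h := hn₀ n hn
  rw [eval_natCast_map_intCast] at h
  exact_mod_cast h

/-- **Logarithmic size of the values**: for `g ∈ ℤ[X]` of degree `d ≥ 1` there is `B` with
`|log |g(n)| - d log n| ≤ B` for every `n ≥ 1` (Mathlib's `Polynomial.isEquivalent_atTop_lead`: `g(t) ~ a t^d`,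
whence `|g(n)| ∈ [½|a| n^d, 2|a| n^d]` for large `n`; the finitely many small `n` — including possible roots, where
`log 0 = 0` — are absorbed into `B`). -/
theorem exists_abs_log_natAbs_eval_sub_le {g : ℤ[X]} (hdeg : 0 < g.natDegree) :
    ∃ B : ℝ, ∀ n : ℕ, 1 ≤ n →
      |Real.log ((g.eval (n : ℤ)).natAbs : ℝ) - g.natDegree * Real.log n| ≤ B := by
  have hinj : Function.Injective (Int.castRingHom ℝ) := Int.cast_injective
  have hdR : (g.map (Int.castRingHom ℝ)).natDegree = g.natDegree := natDegree_map_eq_of_injective hinj _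
  have hg : g ≠ 0 := fun h => by simp [h] at hdeg
  have ha0 : (g.map (Int.castRingHom ℝ)).leadingCoeff ≠ 0 := by
    rw [leadingCoeff_map_of_injective hinj]
    simp only [eq_intCast, ne_eq, Int.cast_eq_zero]
    exact leadingCoeff_ne_zero.mpr hg
  set a : ℝ := (g.map (Int.castRingHom ℝ)).leadingCoeff with ha
  -- `g(n) ~ a n^d` along `ℕ`
  have h := ((g.map (Int.castRingHom ℝ)).isEquivalent_atTop_lead).comp_tendsto
    tendsto_natCast_atTop_atTop
  have hE : (fun n : ℕ => ((g.eval (n : ℤ) : ℤ) : ℝ)) ~[atTop]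
      fun n : ℕ => a * (n : ℝ) ^ g.natDegree := by
    refine (h.congr_left ?_).congr_right ?_
    · exact Eventually.of_forall fun n => eval_natCast_map_intCast g n
    · exact Eventually.of_forall fun n => by rw [Function.comp_apply, hdR]
  have hb := hE.isLittleO.bound (by norm_num : (0 : ℝ) < 1 / 2)
  obtain ⟨N, hN⟩ := eventually_atTop.mp hb
  -- the eventual bound with `B₁ = |log |a|| + log 2`
  have hlarge : ∀ n : ℕ, max N 1 ≤ n →
      |Real.log ((g.eval (n : ℤ)).natAbs : ℝ) - g.natDegree * Real.log n|
        ≤ |Real.log (|a|)| + Real.log 2 := by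
    intro n hn
    have hnN : N ≤ n := (le_max_left _ _).trans hn
    have hn1 : 1 ≤ n := (le_max_right _ _).trans hn
    have hn0 : (0 : ℝ) < n := Nat.cast_pos.mpr (by omega)
    have hV0 : 0 < |a| * (n : ℝ) ^ g.natDegree := by positivity
    have hb' := hN n hnN
    rw [Pi.sub_apply, Real.norm_eq_abs, Real.norm_eq_abs, abs_mul,
      abs_of_pos (pow_pos hn0 _)] at hb'
    -- `|g(n)|` as a real number
    have hG : (((g.eval (n : ℤ)).natAbs : ℕ) : ℝ) = |((g.eval (n : ℤ) : ℤ) : ℝ)| := by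
      rw [Nat.cast_natAbs, Int.cast_abs]
    have hlo : |a| * (n : ℝ) ^ g.natDegree / 2 ≤ |((g.eval (n : ℤ) : ℤ) : ℝ)| := by
      have := abs_sub_abs_le_abs_sub (a * (n : ℝ) ^ g.natDegree) ((g.eval (n : ℤ) : ℤ) : ℝ)
      rw [abs_sub_comm, abs_mul, abs_of_pos (pow_pos hn0 _)] at this
      linarith
    have hhi : |((g.eval (n : ℤ) : ℤ) : ℝ)| ≤ 2 * (|a| * (n : ℝ) ^ g.natDegree) := by
      have := abs_sub_abs_le_abs_sub ((g.eval (n : ℤ) : ℤ) : ℝ) (a * (n : ℝ) ^ g.natDegree)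
      rw [abs_mul, abs_of_pos (pow_pos hn0 _)] at this
      linarith
    have hG0 : 0 < |((g.eval (n : ℤ) : ℤ) : ℝ)| := lt_of_lt_of_le (by positivity) hlo
    have hlogV : Real.log (|a| * (n : ℝ) ^ g.natDegree) = Real.log |a| + g.natDegree * Real.log n := by
      rw [Real.log_mul (abs_pos.mpr ha0).ne' (pow_pos hn0 _).ne', Real.log_pow]
    rw [hG]
    have h1 : Real.log |((g.eval (n : ℤ) : ℤ) : ℝ)| ≤ Real.log 2 + Real.log (|a| * (n : ℝ) ^ g.natDegree) := by
      rw [← Real.log_mul (by norm_num) hV0.ne']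
      exact Real.log_le_log hG0 hhi
    have h2 : Real.log (|a| * (n : ℝ) ^ g.natDegree) - Real.log 2 ≤ Real.log |((g.eval (n : ℤ) : ℤ) : ℝ)| := by
      rw [← Real.log_div hV0.ne' (by norm_num)]
      exact Real.log_le_log (by positivity) hlo
    rw [hlogV] at h1 h2
    rw [abs_le]
    constructor
    · have := neg_abs_le (Real.log |a|)
      linarith
    · have := le_abs_self (Real.log |a|)
      linarith
  -- absorb the finitely many `n < max N 1`
  refine ⟨|Real.log (|a|)| + Real.log 2 + ∑ m ∈ range (max N 1),
      |Real.log ((g.eval (m : ℤ)).natAbs : ℝ) - g.natDegree * Real.log m|, fun n hn1 => ?_⟩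
  have hS0 : 0 ≤ ∑ m ∈ range (max N 1),
      |Real.log ((g.eval (m : ℤ)).natAbs : ℝ) - g.natDegree * Real.log m| :=
    sum_nonneg fun m _ => abs_nonneg _
  have hB1 : 0 ≤ |Real.log (|a|)| + Real.log 2 := by positivity
  by_cases hn : max N 1 ≤ n
  · exact (hlarge n hn).trans (by linarith)
  · have hmem : n ∈ range (max N 1) := mem_range.mpr (not_le.mp hn)
    have := single_le_sum (f := fun m : ℕ =>
        |Real.log ((g.eval (m : ℤ)).natAbs : ℝ) - g.natDegree * Real.log m|)
      (fun m _ => abs_nonneg _) hmem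
    linarith

end Summit.Parity.BatemanHorn.Theorems
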